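import Mathlib
import Summits.Ventures.HodgeRepro.Tier4.Line1.RationalPoints
import Summits.Ventures.HodgeRepro.Tier4.Line4.GASplit
import Summits.Ventures.HodgeRepro.Tier4.Line4.ConvProduct
import Summits.Ventures.HodgeRepro.Tier4.Line4.L1Class

/-!
# Tier4/Line4/ProdFnIntegrable — C-L4-PRODINTEG: the `integrable` field of `L1Class.IsArchCoeff` reduced to the
archimedean integrability alone

Blind re-derivation cell `pub-hodge-repro`, Tier 4 «prove the step» (README §9–§10), seat t4-L4-p1 (prover, LINE L4,
gen 4; self-cut S14994).  Tree path `lean/Summits/Ventures/HodgeRepro/Tier4/Line4/ProdFnIntegrable.lean`.  Mathlib-level;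
no literature.

WHAT IS PROVED.  The field `integrable : ∀ ffin, IsFinFactor W ffin → Integrable (prodFn W finf ffin) S.μ` of the §15
display `IsArchCoeff` (L1Class) asks the `G(𝔸)`-integrability of the product `finf ⊗ ffin` of an archimedean factor and a
compactly supported continuous finite factor, against the Haar measure of `G(𝔸)`.  Through GASplit's Haar uniqueness
(`μ = c • (gaSplit⁻¹)_*(μ_∞ ⊗ μ_f)`) this is the product of the two factor integrabilities:
* `integrable_prodFn` — for `μ = c • (gaSplit⁻¹)_*(μinf ⊗ μfin)`, `finf` integrable on `G_∞` and `ffin` integrable on `G_f`,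
  `prodFn W finf ffin` is `μ`-integrable (`Integrable.mul_prod` on `G_∞ × G_f`, `integrable_map_equiv` along `gaSplit.symm`,
  `Integrable.smul_measure` — the method of ConvProduct's `integrable_conv_integrand_of_isProductFn`);
* `integrable_finFactor` — a finite factor (`IsFinFactor`: continuous, compactly supported on `G_f`) is integrable against
  any Haar measure of `G_f` (`Continuous.integrable_of_hasCompactSupport`);
* `integrable_prodFn_of_isFinFactor` — **the consumer form**: for a Haar `μ` on `G(𝔸)`, a Haar `μinf` on `G_∞` with
  `finf` `μinf`-integrable, and `ffin` a finite factor, `prodFn W finf ffin` is `μ`-integrable (the Haar measure of `G_f`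
  is `Measure.haar`, Haar uniqueness `exists_smul_map_prod_eq_ga`).
So the `integrable` field of a witness `finf` is exactly «`finf` is integrable on `G_∞`» — for D3COEFF's witness the
Harish-Chandra `L¹` criterion at `w₀` (the print) times compact support at the other archimedean places.

Nothing here says anything about the status of the Hodge conjecture for CM abelian varieties, which is NOT proved
(HC_CM is NOT proved by anyone in this repository).
-/

set_option autoImplicit false
noncomputable section
namespace Summit.Ventures.HodgeRepro.Tier4.Line4
open Summit.Ventures.HodgeRepro.Tier4 Summit.Ventures.HodgeRepro.Tier4.Common NumberField
  Summit.Ventures.HodgeRepro.Tier4.Line1 MeasureTheory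
open scoped ComplexConjugate Topology Pointwise NNReal

section ProdFnIntegrable

variable {k : Type} [Field k] [NumberField k] (W : PlaneData k) [MeasurableSpace (GA W)] [BorelSpace (GA W)]

/-- **The product `finf ⊗ ffin` is integrable on `G(𝔸)`** for `μ = c • (gaSplit⁻¹)_*(μinf ⊗ μfin)` when the two factors are
integrable on `G_∞`, `G_f`. -/
theorem integrable_prodFn (μ : Measure (GA W))
    (μinf : Measure (infinitePart W)) [μinf.IsHaarMeasure] (μfin : Measure (finitePart W)) [μfin.IsHaarMeasure]
    (c : ℝ≥0) (hc : μ = c • Measure.map (gaSplit W).symm (μinf.prod μfin))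
    {finf ffin : GA W → ℂ} (hinf : Integrable (fun y : infinitePart W => finf y) μinf)
    (hfin : Integrable (fun y : finitePart W => ffin y) μfin) :
    Integrable (L1Class.prodFn W finf ffin) μ := by
  haveI := locallyCompact_infinitePart W
  haveI := locallyCompact_finitePart W
  haveI := secondCountable_infinitePart W
  haveI := secondCountable_finitePart W
  subst hc
  have hprod : Integrable (fun p : infinitePart W × finitePart W => finf p.1 * ffin p.2) (μinf.prod μfin) :=
    hinf.mul_prod hfin
  have hmeq : Measure.map (gaSplit W).symm (μinf.prod μfin) =
      Measure.map ((gaSplit W).symm.toHomeomorph.toMeasurableEquiv) (μinf.prod μfin) := rfl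
  have hsm : (c • Measure.map (gaSplit W).symm (μinf.prod μfin) : Measure (GA W)) =
      ((c : ENNReal) • Measure.map (gaSplit W).symm (μinf.prod μfin)) := Measure.ext fun _ _ => rfl
  rw [hsm, hmeq]
  refine Integrable.smul_measure ?_ ENNReal.coe_ne_top
  rw [integrable_map_equiv]
  refine hprod.congr (Filter.Eventually.of_forall fun p => ?_)
  show finf p.1 * ffin p.2 = L1Class.prodFn W finf ffin ((gaSplit W).symm p)
  unfold L1Class.prodFn
  rw [← coe_gaSplit_fst, ← coe_gaSplit_snd, (gaSplit W).apply_symm_apply]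

/-- **A finite factor is integrable on `G_f`** against any Haar measure (continuous with compact support on the locally
compact `G_f`). -/
theorem integrable_finFactor (μfin : Measure (finitePart W)) [μfin.IsHaarMeasure] {ffin : GA W → ℂ}
    (hffin : L1Class.IsFinFactor W ffin) : Integrable (fun y : finitePart W => ffin y) μfin := by
  haveI := locallyCompact_finitePart W
  exact (hffin.cont.comp continuous_subtype_val).integrable_of_hasCompactSupport hffin.compact

/-- **C-L4-PRODINTEG, the consumer form**: for a Haar measure `μ` on `G(𝔸)`, an archimedean factor `finf` integrable on
`G_∞` against a Haar measure `μinf`, and a finite factor `ffin` (`IsFinFactor`), the product `finf ⊗ ffin` is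
`μ`-integrable — the `integrable` field of `L1Class.IsArchCoeff` from the `G_∞`-integrability of `finf` alone. -/
theorem integrable_prodFn_of_isFinFactor (μ : Measure (GA W)) [μ.IsHaarMeasure]
    (μinf : Measure (infinitePart W)) [μinf.IsHaarMeasure] {finf ffin : GA W → ℂ}
    (hinf : Integrable (fun y : infinitePart W => finf y) μinf) (hffin : L1Class.IsFinFactor W ffin) :
    Integrable (L1Class.prodFn W finf ffin) μ := by
  haveI := t2Space_GA W
  haveI := locallyCompact_finitePart W
  obtain ⟨c, -, hc⟩ := exists_smul_map_prod_eq_ga W μ μinf (Measure.haar : Measure (finitePart W))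
  exact integrable_prodFn W μ μinf Measure.haar c hc hinf (integrable_finFactor W Measure.haar hffin)

end ProdFnIntegrable

end Summit.Ventures.HodgeRepro.Tier4.Line4

end
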